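import Summits.QuantumFields.YangMills.Theorems.UnitScaleTiltBlockAvgCorrector
import Summits.QuantumFields.YangMills.Theorems.AlphaInputsT3ACv3BoxStokes
import HarnessLib

/-!
# `AlphaInputsT3ACv3RegionCorrector` — STRATEGY B for 2′, NON-ABELIAN (FL) step (n2): THE **REGIONAL** EXACT CORRECTOR FOR BAŁABAN'S BLOCK
# AVERAGING (0.4) — on an ARBITRARY SET `𝒞` of coarse bonds, a coarse field `η`-close to `Ū` there IS `Ū′` there exactly, `U′ = U` except on
# the private central bonds of `𝒞`, using ONLY the plaquettes of the two blocks of each bond of `𝒞` (box-local twin of p1 g9's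
# `BlockAvgCorrector.exists_avgFun_eq_of_near`) — lane `pub-balaban3d` ∕ cell `ym3-torus`, seat `ym-ust-19936-w1` (g0)

WHY (HOME `ym-ust-19936-w1/NONABELIAN-FL-ARCH-w1-g0.md`; OWNER 2026-08-27T23:33:27Z (3) «w1 continues NON-ABELIAN (FL)»).  The displayed row (FL)
`AlphaInputsT3AC.InnerFineLiftsT3` asks, for every charged `W`, a finest field with EXACT `k`-fold (0.4)∕`exp[mean log]` averages `W` on
`bondsIn k Ω_k(h)` ONLY, and fine regularity UNDER `Ω_k(h)` ONLY.  The non-abelian architecture (memo §B) is a LEVEL-BY-LEVEL EXACT lift: at each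
level the smooth candidate (exp of a tensor lift in a regional axial gauge, `…v3RegionAxialGauge`) has averages within `O(ℓ²ε_s²)` of the target by
the tree's one-step linearisation (`BlockAveragingEMLLinearisedBackground`), and is made EXACT by the corrector.  The tree's corrector
(`BlockAvgCorrector.exists_avgFun_eq_of_near`, p1 g9) asks `PlaqSmall t U` on the WHOLE torus and the defect bound at EVERY coarse bond — neither is
available under `Ω_k(h)` (outside the region the fields are uncontrolled).  THIS FILE proves the REGIONAL form:
* §1 `norm_openHol_mul_star_sub_one_le_twoBlock`: the loop variables at `c` read at the straight transporter are within `stokesConst·t` of `1` from the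
  plaquettes of the TWO BLOCKS of `c` alone (alpha-2 g4's `BoxStokes.dist1_loopHol_le_twoBlock`).
* §2 ★★ `exists_avgFun_eq_on_of_near`: for ANY set `𝒞` of coarse bonds (standing range `j + 1 ≤ m + K`): two-block plaquettes within `t` and
  `‖V(c) − Ū(c)‖ ≤ η` for `c ∈ 𝒞`, `stokesConst·t + 2η|I| ≤ |I|⁻¹/16` and `< δ_N` ⟹ `Ū′(c) = V(c)` for all `c ∈ 𝒞`, `U′ = U` off the central bonds
  of `𝒞`, `‖U′(b) − U(b)‖ ≤ 2η|I|` everywhere (same engine `BlockAvgCorrector.exists_eq_of_near` bond by bond; off `𝒞` the private bond is left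
  alone); ★ `dist1_plaqHol_le_of_near`: every plaquette of `U′` is within `4·2η|I|` of that of `U` (pointwise, so regional smallness is inherited).
* §3 ★★ `exists_corrector_on_T3`: the d = 3 `SU(2)` family with constants of `L` alone, `t₀ = (3600(L+1)⁵)⁻¹`, `C = 72L³` (as in
  `BlockAvgCorrector.exists_corrector_T3`): `t + Cη ≤ t₀` ⟹ exact on `𝒞`, moved `≤ Cη` per bond, every plaquette moved `≤ 4Cη`.
HONEST FRAMING.  Elementary (Banach fixed point in `SU(N)`, lattice locality); NOT PRINTED — Bałaban never needs (0.4) to be onto; nothing of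
[Balaban1985Averaging]∕[Balaban1987RG1] asserted.  Count-neutral helper toward R3 2′ (items 19936∕19935∕20520: step (n2) of the non-abelian (FL)
architecture); registry untouched; (FL) itself is NOT proved here; nothing about d = 4, the continuum, or a mass gap; YM₃ on T³ is rung R3, not Clay.

References: T. Bałaban, Commun. Math. Phys. 109 (1987) 249–301 [Balaban1987RG1] ((0.4), (0.18) pp.253–255); CMP 98 (1985) 17–51 [Balaban1985Averaging]
((9) p.19, (19)–(21) p.21, p.25); CMP 102 (1985) 277–309 [Balaban1985Variational] ((11)–(13) pp.279–280).
-/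

set_option autoImplicit false

noncomputable section

open scoped Matrix.Norms.L2Operator NNReal ENNReal
open NormedSpace Function Set Filter Topology

namespace Summit.QuantumFields.YangMills.Theorems.RegionCorrector

open Literature.MathematicalPhysics.QuantumFieldTheory.Balaban1983to89
open MatrixLog ExpMeanLog
open Summit.QuantumFields.YangMills.Theorems.BlockAvgCorrector (stokesConst stokesConst_nonneg emlWeight_pos emlWeight_le_one sum_emlWeight_le
  exists_eq_of_near norm_plaqHol_sub_plaqHol_le stokesConst_T3 emlWeight_T3 ℰp_δ)
open Summit.QuantumFields.YangMills.Theorems.BoxStokes (dist1_loopHol_le_twoBlock)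

/-! ## §0 `SU(N)` read in `M_N(ℂ)` (local one-liners, as in `BlockAvgCorrector`) -/

section Matrices

variable {n : Type*} [Fintype n] [DecidableEq n]

/-- A special unitary matrix has operator norm `1` (nonempty index type). [folklore] -/
private theorem norm_coe_su [Nonempty n] (g : Matrix.specialUnitaryGroup n ℂ) : ‖(g : Matrix n n ℂ)‖ = 1 :=
  UnitaryModel.norm_of_mem_unitaryGroup (Matrix.specialUnitaryGroup_le_unitaryGroup g.2)

/-- The inverse in `SU(N)` is the adjoint. [folklore] -/
private theorem coe_inv_su (g : Matrix.specialUnitaryGroup n ℂ) :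
    ((g⁻¹ : Matrix.specialUnitaryGroup n ℂ) : Matrix n n ℂ) = star (g : Matrix n n ℂ) := rfl

/-- Left multiplication by a special unitary does not increase the norm. [folklore] -/
private theorem norm_coe_mul_le [Nonempty n] (g : Matrix.specialUnitaryGroup n ℂ) (A : Matrix n n ℂ) :
    ‖(g : Matrix n n ℂ) * A‖ ≤ ‖A‖ :=
  (norm_mul_le _ _).trans (by rw [norm_coe_su, one_mul])

/-- Right multiplication by a special unitary does not increase the norm. [folklore] -/
private theorem norm_mul_coe_le [Nonempty n] (A : Matrix n n ℂ) (g : Matrix.specialUnitaryGroup n ℂ) :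
    ‖A * (g : Matrix n n ℂ)‖ ≤ ‖A‖ :=
  (norm_mul_le _ _).trans (by rw [norm_coe_su, mul_one])

end Matrices

/-! ## §1 The loop variables at a coarse bond from the plaquettes of its two blocks -/

section Lattice

open BlockAveraging BlockAveragingHaarAC BlockAveragingEMLHaarAC LatticeWordStokes AveragingRT T4Continuum

variable {P : Params} {j : ℕ} {n : Type*} [Fintype n] [DecidableEq n] [Nonempty n]

/-- In the matrix model `dist1 g = ‖g − 1‖`. [folklore] -/
private theorem dist1_eq (g : Matrix.specialUnitaryGroup n ℂ) : dist1 g = ‖(g : Matrix n n ℂ) - 1‖ := rfl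

/-- **THE LOOP VARIABLES AT `c`, READ AT THE STRAIGHT TRANSPORTER, FROM THE TWO BLOCKS OF `c` ONLY** (standing range): if every plaquette whose
lower-left and upper-right corners have their blocks among `{c₋, c₊}` is within `t ≥ 0` of `1`, then `‖V_i·W₀* − 1‖ ≤ stokesConst·t`, `W₀ = U(c)` the
straight transporter (`BoxStokes.dist1_loopHol_le_twoBlock`; twin of `BlockAvgCorrector.norm_openHol_mul_star_sub_one_le`). [cite: Balaban1987RG1, (0.4) p.253] -/
theorem norm_openHol_mul_star_sub_one_le_twoBlock (hj : j + 1 ≤ P.m + P.K) {t : ℝ} (ht : 0 ≤ t)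
    {U : GaugeField P j (Matrix.specialUnitaryGroup n ℂ)} (c : PBond P (j+1))
    (hU : ∀ q : Plaq P j, (blockOf q.src = c.src ∨ blockOf q.src = c.tgt) →
      (blockOf ((q.src.shift q.μ).shift q.ν) = c.src ∨ blockOf ((q.src.shift q.μ).shift q.ν) = c.tgt) →
      dist1 (GaugeField.plaqHol U q) ≤ t)
    (i : Idx P) :
    ‖((openHol U c i : Matrix.specialUnitaryGroup n ℂ) : Matrix n n ℂ) * star ((axialAvg U c : Matrix.specialUnitaryGroup n ℂ) : Matrix n n ℂ) - 1‖ ≤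
      stokesConst P * t := by
  have h := dist1_loopHol_le_twoBlock hj ht c hU i
  rw [loopHol_eq_openHol_mul, dist1_eq, Submonoid.coe_mul, coe_inv_su] at h
  exact h

/-! ## §2 The regional exact corrector -/

/-- **★★ THE REGIONAL EXACT CORRECTOR FOR BAŁABAN'S BLOCK AVERAGING (0.4) WITH THE PRINTED EXP-MEAN-LOG AVERAGE ON `SU(N)`.**  On a torus in the
standing range `j + 1 ≤ m + K`, for ANY set `𝒞` of coarse bonds: if for every `c ∈ 𝒞` the plaquettes of the two blocks of `c` are within `t` of `1` and
`‖V(c) − Ū(c)‖ ≤ η`, with `stokesConst·t + 2η|I| ≤ |I|⁻¹/16` and `< δ_N`, then there is `U′` with `Ū′(c) = V(c)` for every `c ∈ 𝒞`, `U′ = U` off the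
central crossing bonds `β(c)`, `c ∈ 𝒞`, and `‖U′(b) − U(b)‖ ≤ 2η|I|` on every bond.  Nothing is asked or concluded at the coarse bonds outside `𝒞`.
(Bond by bond: the fibre equation at `c ∈ 𝒞` is solved by the engine `BlockAvgCorrector.exists_eq_of_near` in the guard ball, the private bond of
`c ∉ 𝒞` is left alone; locality `T4TriangularPushforward.apply_resample_eq` assembles the simultaneous update.)  NOT PRINTED; elementary.
[cite: Balaban1987RG1, (0.4) p.253] -/
theorem exists_avgFun_eq_on_of_near (hj : j + 1 ≤ P.m + P.K) {t η : ℝ} (ht : 0 ≤ t) (hη : 0 ≤ η)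
    (hsmall : stokesConst P * t + 2 * η / emlWeight P ≤ emlWeight P / 16)
    (hguard : stokesConst P * t + 2 * η / emlWeight P < (expMeanLogSU (n := n)).δ)
    (U : GaugeField P j (Matrix.specialUnitaryGroup n ℂ)) (𝒞 : Set (PBond P (j+1)))
    (hU : ∀ c ∈ 𝒞, ∀ q : Plaq P j, (blockOf q.src = c.src ∨ blockOf q.src = c.tgt) →
      (blockOf ((q.src.shift q.μ).shift q.ν) = c.src ∨ blockOf ((q.src.shift q.μ).shift q.ν) = c.tgt) →
      dist1 (GaugeField.plaqHol U q) ≤ t)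
    (V : GaugeField P (j+1) (Matrix.specialUnitaryGroup n ℂ))
    (hV : ∀ c ∈ 𝒞, ‖((V c : Matrix.specialUnitaryGroup n ℂ) : Matrix n n ℂ) -
      ((avgFun (expMeanLogSU (n := n)) U c : Matrix.specialUnitaryGroup n ℂ) : Matrix n n ℂ)‖ ≤ η) :
    ∃ U' : GaugeField P j (Matrix.specialUnitaryGroup n ℂ),
      (∀ c ∈ 𝒞, avgFun (expMeanLogSU (n := n)) U' c = V c) ∧
      (∀ b, (∀ c ∈ 𝒞, centralBond c ≠ b) → U' b = U b) ∧
      ∀ b, ‖((U' b : Matrix.specialUnitaryGroup n ℂ) : Matrix n n ℂ) - (U b : Matrix n n ℂ)‖ ≤ 2 * η / emlWeight P := by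
  classical
  have hκ := emlWeight_pos P
  have hκ1 := emlWeight_le_one P
  set R : ℝ := 2 * η / emlWeight P with hR_def
  have hR0 : 0 ≤ R := div_nonneg (by positivity) hκ.le
  have hr₀ : 0 ≤ stokesConst P * t := mul_nonneg (stokesConst_nonneg P) ht
  -- the fibre equation at each coarse bond of `𝒞`
  have hfib : ∀ c ∈ 𝒞, ∃ W : Matrix.specialUnitaryGroup n ℂ,
      ‖(W : Matrix n n ℂ) - ((axialAvg U c : Matrix.specialUnitaryGroup n ℂ) : Matrix n n ℂ)‖ ≤ R ∧
        W ∈ fibreGuard (expMeanLogSU (n := n)) U c ∧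
        (expMeanLogSU (n := n)).avg (fibreFamily U c W) * W = V c := by
    intro c hc
    -- the ball of radius `R` about `W₀ = U(c)` lies in the guard (two-block plaquettes only)
    have hball : ∀ W : Matrix.specialUnitaryGroup n ℂ,
        ‖(W : Matrix n n ℂ) - ((axialAvg U c : Matrix.specialUnitaryGroup n ℂ) : Matrix n n ℂ)‖ ≤ R →
          W ∈ fibreGuard (expMeanLogSU (n := n)) U c := by
      intro W hW i
      by_cases hci : IsCentral c i
      · rw [fibreFamily_of_isCentral U c W i hci, GaugeGroup.dist1_one]; exact (expMeanLogSU (n := n)).δ_pos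
      · rw [dist1_fibreFamily_of_not_isCentral U c W i hci]
        have h1 : ((openHol U c i : Matrix.specialUnitaryGroup n ℂ) : Matrix n n ℂ) * star (W : Matrix n n ℂ) - 1 =
            (((openHol U c i : Matrix.specialUnitaryGroup n ℂ) : Matrix n n ℂ) * star ((axialAvg U c : Matrix.specialUnitaryGroup n ℂ) : Matrix n n ℂ) - 1) +
              ((openHol U c i : Matrix.specialUnitaryGroup n ℂ) : Matrix n n ℂ) * star ((W : Matrix n n ℂ) - ((axialAvg U c : Matrix.specialUnitaryGroup n ℂ) : Matrix n n ℂ)) := by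
          rw [star_sub]; noncomm_ring
        rw [h1]
        refine (norm_add_le _ _).trans_lt ?_
        have h2 := norm_openHol_mul_star_sub_one_le_twoBlock hj ht c (hU c hc) i
        have h3 : ‖((openHol U c i : Matrix.specialUnitaryGroup n ℂ) : Matrix n n ℂ) * star ((W : Matrix n n ℂ) - ((axialAvg U c : Matrix.specialUnitaryGroup n ℂ) : Matrix n n ℂ))‖ ≤ R :=
          (norm_coe_mul_le _ _).trans (by rw [norm_star]; exact hW)
        linarith
    have hY : ‖((V c : Matrix.specialUnitaryGroup n ℂ) : Matrix n n ℂ) -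
        (((expMeanLogSU (n := n)).avg (fibreFamily U c (axialAvg U c)) * axialAvg U c : Matrix.specialUnitaryGroup n ℂ) : Matrix n n ℂ)‖ ≤ η := by
      have h0 : (expMeanLogSU (n := n)).avg (fibreFamily U c (axialAvg U c)) * axialAvg U c = avgFun (expMeanLogSU (n := n)) U c := by
        have hmem : axialAvg U c ∈ fibreGuard (expMeanLogSU (n := n)) U c := hball _ (by rw [sub_self, norm_zero]; exact hR0)
        rw [← fibreMap_of_mem _ U c hmem, axialAvg_eq_pre_mul_mul_post U c, ← avgFun_update_centralBond_self hj,
          update_eq_self]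
      rw [h0]; exact hV c hc
    obtain ⟨W, hW, hKW⟩ := exists_eq_of_near (offHol U c) (fun _ => emlWeight_nonneg P) hκ hκ1 (sum_emlWeight_le c)
      (K := fun W => (expMeanLogSU (n := n)).avg (fibreFamily U c W) * W) (S := fibreGuard (expMeanLogSU (n := n)) U c)
      (fun W hW => coe_fibreCore_eq U c hW) hr₀ hη hsmall hball
      (fun k => norm_openHol_mul_star_sub_one_le_twoBlock hj ht c (hU c hc) _) hY
    exact ⟨W, hW, hball W hW, hKW⟩
  -- extend the choice to all coarse bonds: off `𝒞` the straight transporter itself (no move)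
  have hfib' : ∀ c : PBond P (j+1), ∃ W : Matrix.specialUnitaryGroup n ℂ,
      ‖(W : Matrix n n ℂ) - ((axialAvg U c : Matrix.specialUnitaryGroup n ℂ) : Matrix n n ℂ)‖ ≤ R ∧
        (c ∈ 𝒞 → W ∈ fibreGuard (expMeanLogSU (n := n)) U c ∧ (expMeanLogSU (n := n)).avg (fibreFamily U c W) * W = V c) ∧
        (c ∉ 𝒞 → W = axialAvg U c) := by
    intro c
    by_cases hc : c ∈ 𝒞
    · obtain ⟨W, h1, h2, h3⟩ := hfib c hc
      exact ⟨W, h1, fun _ => ⟨h2, h3⟩, fun h => absurd hc h⟩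
    · exact ⟨axialAvg U c, by rw [sub_self, norm_zero]; exact hR0, fun h => absurd h hc, fun _ => rfl⟩
  choose Wc hWR hWin hWout using hfib'
  -- the corrected private bonds and the resampled configuration
  set g : PBond P (j+1) → Matrix.specialUnitaryGroup n ℂ := fun c => (pre U c)⁻¹ * Wc c * (post U c)⁻¹ with hg_def
  have hg : ∀ c, pre U c * g c * post U c = Wc c := by
    intro c; simp only [hg_def]; group
  refine ⟨extend centralBond g U, ?_, ?_, ?_⟩
  · intro c hc
    rw [T4TriangularPushforward.apply_resample_eq (isLocal_avgFun hj _) (centralBond_injective hj) U g c,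
      avgFun_update_centralBond_self hj, hg c, fibreMap_of_mem _ U c (hWin c hc).1, (hWin c hc).2]
  · intro b hb
    by_cases hcb : ∃ c, centralBond c = b
    · obtain ⟨c, rfl⟩ := hcb
      have hc : c ∉ 𝒞 := fun hc => hb c hc rfl
      rw [(centralBond_injective hj).extend_apply]
      show (pre U c)⁻¹ * Wc c * (post U c)⁻¹ = U (centralBond c)
      rw [hWout c hc, axialAvg_eq_pre_mul_mul_post]; group
    · exact extend_apply' _ _ _ fun ⟨c, hc⟩ => hcb ⟨c, hc⟩
  · intro b
    by_cases hb : ∃ c, centralBond c = b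
    · obtain ⟨c, rfl⟩ := hb
      rw [(centralBond_injective hj).extend_apply]
      have hUc : U (centralBond c) = (pre U c)⁻¹ * axialAvg U c * (post U c)⁻¹ := by
        rw [axialAvg_eq_pre_mul_mul_post]; group
      rw [hUc, hg_def]
      simp only [Submonoid.coe_mul]
      rw [← sub_mul, ← mul_sub]
      exact (norm_mul_coe_le _ _).trans ((norm_coe_mul_le _ _).trans (hWR c))
    · rw [extend_apply' _ _ _ hb, sub_self, norm_zero]; exact hR0

/-- **★ THE CORRECTION MOVES EVERY PLAQUETTE BY AT MOST FOUR BOND DISPLACEMENTS** (pointwise, so every REGIONAL smallness of `U` is inherited by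
`U′` with `t ↦ t + 4ε`): `‖U′(b) − U(b)‖ ≤ ε` for all `b` ⟹ `dist1(U′(∂p)) ≤ dist1(U(∂p)) + 4ε` for every plaquette `p`.
[cite: Balaban1987RG1, (0.18) p.255] -/
theorem dist1_plaqHol_le_of_near {U U' : GaugeField P j (Matrix.specialUnitaryGroup n ℂ)} {ε : ℝ}
    (hε : ∀ b, ‖((U' b : Matrix.specialUnitaryGroup n ℂ) : Matrix n n ℂ) - (U b : Matrix n n ℂ)‖ ≤ ε) (p : Plaq P j) :
    dist1 (GaugeField.plaqHol U' p) ≤ dist1 (GaugeField.plaqHol U p) + 4 * ε := by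
  have h1 := norm_plaqHol_sub_plaqHol_le hε p
  rw [dist1_eq, dist1_eq]
  have h3 : ((GaugeField.plaqHol U' p : Matrix.specialUnitaryGroup n ℂ) : Matrix n n ℂ) - 1 =
      (((GaugeField.plaqHol U' p : Matrix.specialUnitaryGroup n ℂ) : Matrix n n ℂ) - ((GaugeField.plaqHol U p : Matrix.specialUnitaryGroup n ℂ) : Matrix n n ℂ)) +
        (((GaugeField.plaqHol U p : Matrix.specialUnitaryGroup n ℂ) : Matrix n n ℂ) - 1) := by abel
  rw [h3]
  refine (norm_add_le _ _).trans ?_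
  linarith

end Lattice

/-! ## §3 The d = 3 family on `SU(2)`: constants depending on the block size alone -/

section Family

open BlockAveraging BlockAveragingHaarAC BlockAveragingEMLHaarAC LatticeWordStokes AveragingRT T4Continuum
open T3ContinuumYM3Torus
open T3UnitLawDensityEML (ℰp)

/-- **★★ THE REGIONAL EXACT CORRECTOR FOR THE d = 3 FAMILY ON `SU(2)`, CONSTANTS DEPENDING ON `L` ALONE**: for every block size `L` there are
`t₀ = (3600(L+1)⁵)⁻¹ > 0` and `C = 72L³` (the constants of `BlockAvgCorrector.exists_corrector_T3`) such that on every torus of every run of every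
member of the family with block size `L` (standing range `j + 1 ≤ m + K`), for every SET `𝒞` of coarse bonds: two-block plaquettes of `U` within
`t` and `‖V(c) − Ū(c)‖ ≤ η` for `c ∈ 𝒞`, and `t + Cη ≤ t₀` ⟹ `Ū′(c) = V(c)` EXACTLY for all `c ∈ 𝒞`, `U′ = U` off the central bonds of `𝒞`,
`‖U′(b) − U(b)‖ ≤ Cη` on every bond, and every plaquette of `U′` within `4Cη` of the corresponding plaquette of `U`.  The exactness step of the
level-by-level non-abelian (FL) construction under `Ω_k(h)`.  NOT PRINTED. [cite: Balaban1987RG1, (0.4)/(0.18) p.253; Balaban1985Variational, (11)-(13) pp.279-280] -/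
theorem exists_corrector_on_T3 (L : ℕ) : ∃ t₀ C : ℝ, 0 < t₀ ∧ 0 ≤ C ∧
    ∀ F : T3Family, F.L = L → ∀ (K j : ℕ), j + 1 ≤ F.m + K →
      ∀ (t η : ℝ), 0 ≤ t → 0 ≤ η → t + C * η ≤ t₀ →
        ∀ (U : GaugeField (F.P K) j (Matrix.specialUnitaryGroup (Fin 2) ℂ)) (𝒞 : Set (PBond (F.P K) (j + 1))),
          (∀ c ∈ 𝒞, ∀ q : Plaq (F.P K) j, (blockOf q.src = c.src ∨ blockOf q.src = c.tgt) →
            (blockOf ((q.src.shift q.μ).shift q.ν) = c.src ∨ blockOf ((q.src.shift q.μ).shift q.ν) = c.tgt) →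
            dist1 (GaugeField.plaqHol U q) ≤ t) →
          ∀ V : GaugeField (F.P K) (j + 1) (Matrix.specialUnitaryGroup (Fin 2) ℂ),
            (∀ c ∈ 𝒞, ‖((V c : Matrix.specialUnitaryGroup (Fin 2) ℂ) : Matrix (Fin 2) (Fin 2) ℂ) -
              ((avgFun ℰp U c : Matrix.specialUnitaryGroup (Fin 2) ℂ) : Matrix (Fin 2) (Fin 2) ℂ)‖ ≤ η) →
            ∃ U' : GaugeField (F.P K) j (Matrix.specialUnitaryGroup (Fin 2) ℂ),
              (∀ c ∈ 𝒞, avgFun ℰp U' c = V c) ∧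
              (∀ b, (∀ c ∈ 𝒞, centralBond c ≠ b) → U' b = U b) ∧
              (∀ b, ‖((U' b : Matrix.specialUnitaryGroup (Fin 2) ℂ) : Matrix (Fin 2) (Fin 2) ℂ) - (U b : Matrix (Fin 2) (Fin 2) ℂ)‖ ≤ C * η) ∧
              ∀ p : Plaq (F.P K) j, dist1 (GaugeField.plaqHol U' p) ≤ dist1 (GaugeField.plaqHol U p) + 4 * (C * η) := by
  refine ⟨((3600 : ℝ) * ((L : ℝ) + 1) ^ 5)⁻¹, 72 * ((L : ℝ)) ^ 3, by positivity, by positivity, ?_⟩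
  intro F hFL K j hj t η ht hη hle U 𝒞 hU V hV
  subst hFL
  have hL1 : (1 : ℝ) ≤ F.L := by exact_mod_cast F.hL.2.le
  have hL : (0 : ℝ) < F.L := by linarith
  -- `2η/|I|⁻¹ = 72 L³ η`
  have hC : 2 * η / emlWeight (F.P K) = 72 * (F.L : ℝ) ^ 3 * η := by
    rw [emlWeight_T3]; field_simp; ring
  -- the smallness hypothesis of the general corrector
  have hsmall : stokesConst (F.P K) * t + 2 * η / emlWeight (F.P K) ≤ emlWeight (F.P K) / 16 := by
    rw [hC, stokesConst_T3, emlWeight_T3]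
    have hS1 : (1 : ℝ) ≤ 25 * (F.L : ℝ) ^ 2 / 4 := by nlinarith
    have h72 : 0 ≤ 72 * (F.L : ℝ) ^ 3 * η := by positivity
    have h1 : 25 * (F.L : ℝ) ^ 2 / 4 * t + 72 * (F.L : ℝ) ^ 3 * η ≤ 25 * (F.L : ℝ) ^ 2 / 4 * (t + 72 * (F.L : ℝ) ^ 3 * η) := by
      nlinarith
    have h2 : t + 72 * (F.L : ℝ) ^ 3 * η ≤ ((3600 : ℝ) * (F.L : ℝ) ^ 5)⁻¹ := by
      refine hle.trans ?_
      rw [inv_le_inv₀ (by positivity) (by positivity)]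
      gcongr; linarith
    calc 25 * (F.L : ℝ) ^ 2 / 4 * t + 72 * (F.L : ℝ) ^ 3 * η ≤ 25 * (F.L : ℝ) ^ 2 / 4 * ((3600 : ℝ) * (F.L : ℝ) ^ 5)⁻¹ :=
          h1.trans (mul_le_mul_of_nonneg_left h2 (by positivity))
      _ = ((36 : ℝ) * (F.L : ℝ) ^ 3)⁻¹ / 16 := by field_simp; ring
  have hguard : stokesConst (F.P K) * t + 2 * η / emlWeight (F.P K) < (ℰp).δ := by
    refine hsmall.trans_lt ?_
    rw [ℰp_δ, emlWeight_T3]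
    have hL3 : (1 : ℝ) ≤ (F.L : ℝ) ^ 3 := one_le_pow₀ hL1
    have : ((36 : ℝ) * (F.L : ℝ) ^ 3)⁻¹ ≤ 1 := inv_le_one_of_one_le₀ (by nlinarith)
    linarith
  obtain ⟨U', h1, h2, h3⟩ := exists_avgFun_eq_on_of_near (n := Fin 2) (P := F.P K) hj ht hη hsmall hguard U 𝒞 hU V hV
  refine ⟨U', h1, h2, fun b => ?_, fun p => ?_⟩
  · rw [← hC]; exact h3 b
  · rw [← hC]; exact dist1_plaqHol_le_of_near h3 p

end Family

end Summit.QuantumFields.YangMills.Theorems.RegionCorrector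

end
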